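import Summits.BirchSwinnertonDyer.BirchSwinnertonDyer.Theorems.ManinLocalTwoThreeManinConstantTwentySevenOfCDT
import Literature.NumberTheory.EllipticCurves.ComplexMultiplicationTwistIsogenyCertProofs
import Literature.NumberTheory.EllipticCurves.ComplexMultiplicationLFunctionIsogenyHoldsProofs
import Literature.NumberTheory.EllipticCurves.IsogenyVariableChangeProofs
import Literature.NumberTheory.EllipticCurves.IsogenyCompProofs
import Literature.NumberTheory.NumberFields.EisensteinFieldSelmerInert
import HarnessLib

/-!
# `X₀(27) = 27a1 : y² + y = x³ − 7` is modular with newform `η(3τ)²η(9τ)²`, FACT-FREE; its small coefficients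
(route `ManinLocalTwoThree`, crux C3 `ManinPrimeToThreeAtNine` stmt-BirchSwinnertonDyer-22968; cell bsd-f2-manin, prover seat p3 gen 22;
`--supports stmt-BirchSwinnertonDyer-22968`)

p3's and an's `HeckeThetaTwentySeven` proves `IsNewformOf 27a3 (η(3τ)²η(9τ)²)` for `27a3 : y² + y = x³` (Hecke's theta series of `ℚ(ω)` mod `(3)`).  The
OPTIMAL curve of the class — `X₀(27)` itself — is `27a1 : y² + y = x³ − 7` (kernel conductor `27`, `LevelTwentySeven.conductorNorm_twentySevenA1`).  This
file transports modularity to it with NO printed fact: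

* §1 **`27a3 ∼ 27a1` over `ℚ`** (`isIsogenous_twentySevenA3_twentySevenA1`): `27a3` has `j = 0`, CM by `ℤ[ω]`, so it is `ℚ`-isogenous to its quadratic
  twist by `d_K = −3` (tree THEOREM `isIsogenous_quadraticTwist_cmFieldDiscr_holds`, Burungale–Flach Cor. 2 / Milne); that twist is `y² = x³ − 27/4`,
  which is `27a1` after `y ↦ y − ½` (`smul_twentySevenA1_eq_quadraticTwist`).  Hence **`L(27a1, s) = L(27a3, s)`** coefficientwise
  (tree THEOREM `LFunction_eq_of_isIsogenous_holds`, Knapp 11.67): `lFunction_twentySevenA1_eq_twentySevenA3`.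
* §2 **`isNewformOf_twentySevenA1_etaProduct : IsNewformOf 27a1 (η(3τ)²η(9τ)²)`** and the `ℤ`-model form
  `isNewformOf_baseChange_twentySevenA1_etaProduct` — VERBATIM the binders `(g : CuspForm (Gamma0 27) 2) (hg : IsNewformOf ((⟨0,0,1,0,-7⟩ : ℤ).baseChange ℚ) g)`
  of `Theorems/ResidualThetaTransportAtTwoSignedMuVanishingAtTwoPlusMultOne{Class157113h,CuspSpanAnchorClasses}.lean`, now instantiable with `g := η(3τ)²η(9τ)²`;
  a fact-free `X₀(27)`-datum ON `27a1` (`nonempty_modularParametrizationData_twentySevenA1`, unconditional version of p3's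
  `NonVacuityTwentySeven.nonempty_modularParametrizationData_twentySevenA1 (hnf)`), and `BCDT.IsModular 27a1`.
* §3 **small coefficients**: `2`, `5`, `11`, `17`, `23` are inert in `ℤ[ω]` (no ideal of norm `p`), and the prime above `3` is not prime to `(3)`, so
  `a_p(27a3) = a_p(27a1) = a_p(η(3τ)²η(9τ)²) = 0` for `p ∈ {2, 3, 5, 11, 17, 23}` (`lFunction_twentySevenA3_eq_zero_of_inert`, `…_three`); in the `ℤ`-model currency
  these are the parity binders `hA11`, `hA23`, `hA3` (`Even (a_{11})`, `Even (a_{23})`, `Even (a₃)`) of the same two `ResidualThetaTransportAtTwo…` records —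
  DISCHARGED (`even_lFunction_baseChange_twentySevenA1_eleven/twentyThree/three`).

HONEST FRAMING: everything here is unconditional (standard axioms).  Nothing here computes a Manin constant, proves C3, Manin's conjecture or BSD; the
items stay OPEN as filed.  No definition, no named fact, no sorry.
[cite: BurungaleFlach2024, Cor. 2] [cite: Knapp1993, Thm. 11.67] [cite: IrelandRosen1990, Prop. 9.1.4, Ch. 18 §7] [cite: CremonaAlgorithms1997, Table 1 (27a1, 27a3)]
[cite: Koehler2011, §1]
-/

set_option autoImplicit false
-- lint-debt: the directory name repeats the summit name (sibling precedent `ManinLocalTwoThreeManinConstantTwentySevenOfCDT.lean`)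
set_option linter.dupNamespace false

noncomputable section

open scoped MatrixGroups ModularForm
open NumberField IsDedekindDomain Finset CongruenceSubgroup WeierstrassCurve
open Literature.NumberTheory.NumberFields Literature.NumberTheory.NumberFields.K3
open Literature.NumberTheory.LFunctions Literature.NumberTheory.LFunctions.NumberField
open Literature.NumberTheory.LFunctions.EisensteinGrossen
open Literature.NumberTheory.EllipticCurves Literature.NumberTheory.EllipticCurves.ModularForms
open Literature.NumberTheory.Automorphic
open Summit.BirchSwinnertonDyer.Rank1Residual.Additive

namespace Summit.BirchSwinnertonDyer.BirchSwinnertonDyer.Theorems.ManinLocalTwoThree.TwentySevenA1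

/-! ## §1 `27a3 ∼ 27a1`: the CM twist by `−3` -/

/-- The quadratic twist of `27a3 = [0,0,1,0,0]` by `−3` is `y² = x³ − 27/4` (`b₂ = b₄ = 0`, `b₆ = 1`). [folklore] -/
theorem quadraticTwist_twentySevenA3_neg_three :
    (⟨0, 0, 1, 0, 0⟩ : WeierstrassCurve ℚ).quadraticTwist (-3) = ⟨0, 0, 0, 0, -27 / 4⟩ := by
  ext <;> norm_num [quadraticTwist, WeierstrassCurve.b₂, WeierstrassCurve.b₄, WeierstrassCurve.b₆]

/-- `y ↦ y − ½` takes `27a1 = [0,0,1,0,−7]` to `y² = x³ − 27/4`. [folklore] -/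
theorem smul_twentySevenA1_eq :
    (⟨1, 0, 0, -1 / 2⟩ : WeierstrassCurve.VariableChange ℚ) • (⟨0, 0, 1, 0, -7⟩ : WeierstrassCurve ℚ) = ⟨0, 0, 0, 0, -27 / 4⟩ := by
  ext <;> norm_num [WeierstrassCurve.variableChange_a₁, WeierstrassCurve.variableChange_a₂, WeierstrassCurve.variableChange_a₃,
    WeierstrassCurve.variableChange_a₄, WeierstrassCurve.variableChange_a₆]

/-- **`27a3 ∼ 27a1` over `ℚ`** (CM by `ℤ[ω]`: `27a3` is isogenous to its twist by `−3` — tree theorem `isIsogenous_quadraticTwist_cmFieldDiscr_holds` —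
and that twist is `ℚ`-isomorphic to `27a1`).  UNCONDITIONAL. [cite: BurungaleFlach2024, Cor. 2] [cite: CremonaAlgorithms1997, Table 1 (27a)] -/
theorem isIsogenous_twentySevenA3_twentySevenA1 :
    IsIsogenous (⟨0, 0, 1, 0, 0⟩ : WeierstrassCurve ℚ) (⟨0, 0, 1, 0, -7⟩ : WeierstrassCurve ℚ) := by
  haveI h3 : (⟨0, 0, 1, 0, 0⟩ : WeierstrassCurve ℚ).IsElliptic :=
    ⟨by norm_num [WeierstrassCurve.Δ, WeierstrassCurve.b₂, WeierstrassCurve.b₄, WeierstrassCurve.b₆, WeierstrassCurve.b₈]⟩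
  haveI := LevelTwentySeven.isElliptic_twentySevenA1
  have hj : (⟨0, 0, 1, 0, 0⟩ : WeierstrassCurve ℚ).j = 0 := by
    rw [j_eq_c₄_pow_div]
    norm_num [WeierstrassCurve.c₄, WeierstrassCurve.b₂, WeierstrassCurve.b₄]
  have hmem : (⟨0, 0, 1, 0, 0⟩ : WeierstrassCurve ℚ).j ∈ maximalCMJInvariants := by
    rw [hj]; simp [maximalCMJInvariants]
  have htw := isIsogenous_quadraticTwist_cmFieldDiscr_holds (⟨0, 0, 1, 0, 0⟩ : WeierstrassCurve ℚ) hmem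
  rw [hj, show ((cmFieldDiscr 0 : ℤ) : ℚ) = -3 by norm_num [cmFieldDiscr], quadraticTwist_twentySevenA3_neg_three] at htw
  exact htw.trans' (isIsogenous_of_smul_eq' smul_twentySevenA1_eq)

/-- **`L(27a1, s) = L(27a3, s)`** (the formal `L`-function is an isogeny invariant: tree theorem `LFunction_eq_of_isIsogenous_holds`, Knapp 11.67).
UNCONDITIONAL. [cite: Knapp1993, Thm. 11.67] -/
theorem lFunction_twentySevenA1_eq_twentySevenA3 :
    (⟨0, 0, 1, 0, -7⟩ : WeierstrassCurve ℚ).LFunction = (⟨0, 0, 1, 0, 0⟩ : WeierstrassCurve ℚ).LFunction := by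
  haveI : (⟨0, 0, 1, 0, 0⟩ : WeierstrassCurve ℚ).IsElliptic :=
    ⟨by norm_num [WeierstrassCurve.Δ, WeierstrassCurve.b₂, WeierstrassCurve.b₄, WeierstrassCurve.b₆, WeierstrassCurve.b₈]⟩
  haveI := LevelTwentySeven.isElliptic_twentySevenA1
  exact (LFunction_eq_of_isIsogenous_holds _ _ isIsogenous_twentySevenA3_twentySevenA1).symm

/-! ## §2 `X₀(27) = 27a1` is modular with newform `η(3τ)²η(9τ)²` -/

/-- **`aₙ(η(3τ)²η(9τ)²) = aₙ(27a1)` for all `n`**, FACT-FREE. [cite: Koehler2011, §1] [cite: CremonaAlgorithms1997, Table 3 (N = 27)] -/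
theorem cuspCoeff_etaProductTwentySeven_eq_lFunction_twentySevenA1 (n : ℕ) :
    cuspCoeff cuspFormEtaProductTwentySeven n = (((⟨0, 0, 1, 0, -7⟩ : WeierstrassCurve ℚ).LFunction n : ℤ) : ℂ) := by
  rw [lFunction_twentySevenA1_eq_twentySevenA3]
  exact HeckeThetaTwentySeven.cuspCoeff_etaProductTwentySeven_eq_lFunction_twentySevenA3 n

/-- **`X₀(27) ≅ 27a1 : y² + y = x³ − 7` is modular, with newform `η(3τ)²η(9τ)²`** (`IsNewformOf`), UNCONDITIONALLY.
[cite: Koehler2011, §1] [cite: CremonaAlgorithms1997, Table 1 (27a1)] -/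
theorem isNewformOf_twentySevenA1_etaProduct : IsNewformOf (⟨0, 0, 1, 0, -7⟩ : WeierstrassCurve ℚ) cuspFormEtaProductTwentySeven :=
  NonVacuityTwentySeven.isNewformOf_etaProductTwentySeven_of_cuspCoeff_eq cuspCoeff_etaProductTwentySeven_eq_lFunction_twentySevenA1

/-- The same for the `ℤ`-model `[0,0,1,0,−7]` base-changed to `ℚ` — VERBATIM the binders `(g) (hg : IsNewformOf ((⟨0,0,1,0,-7⟩ : WeierstrassCurve ℤ).baseChange ℚ) g)`
of the `ResidualThetaTransportAtTwoSignedMuVanishingAtTwoPlusMultOne…` records, instantiable with `g := cuspFormEtaProductTwentySeven`. [cite: CremonaAlgorithms1997, Table 1 (27a1)] -/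
theorem isNewformOf_baseChange_twentySevenA1_etaProduct :
    IsNewformOf (((⟨0, 0, 1, 0, -7⟩ : WeierstrassCurve ℤ).baseChange ℚ)) cuspFormEtaProductTwentySeven := by
  rw [IntModelTam.baseChange_rat_mk_int, ← LevelTwentySeven.mk_twentySevenA1_eq_cast]
  exact isNewformOf_twentySevenA1_etaProduct

/-- **An `X₀(27)`-datum ON `27a1` exists, UNCONDITIONALLY** (Literature's fact-free datum package; the modularity-conditional version was p3's
`NonVacuityTwentySeven.nonempty_modularParametrizationData_twentySevenA1 (hnf)`). [cite: EdixhovenManin1991, Prop. 2] -/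
theorem nonempty_modularParametrizationData_twentySevenA1 :
    Nonempty (ModularParametrizationData (⟨0, 0, 1, 0, -7⟩ : WeierstrassCurve ℚ) 27) := by
  haveI := LevelTwentySeven.isElliptic_twentySevenA1
  haveI : NeZero (27 : ℕ) := ⟨by decide⟩
  exact nonempty_modularParametrizationData_of_isNewformOf isNewformOf_twentySevenA1_etaProduct

/-- **`27a1` is modular in the sense of BCDT (2)** (newform at the conductor level `27`), UNCONDITIONALLY. [cite: CremonaAlgorithms1997, Table 1 (27a1)] -/
theorem isModular_twentySevenA1 [NeZero ((⟨0, 0, 1, 0, -7⟩ : WeierstrassCurve ℚ).conductorNorm ℤ)] :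
    BCDT.IsModular (⟨0, 0, 1, 0, -7⟩ : WeierstrassCurve ℚ) :=
  BCDT.isModular_of_isNewformOf_of_eq _ isNewformOf_twentySevenA1_etaProduct LevelTwentySeven.conductorNorm_twentySevenA1.symm

/-! ## §3 Small coefficients: inert primes and the prime above `3` -/

/-- **No ideal of `ℤ[ω]` has norm `p` for an inert rational prime `p`** (`p = 2` or `p ≡ 2 (mod 3)`: `(p)` is a prime of norm `p²`).
[cite: IrelandRosen1990, Prop. 9.1.4] -/
theorem absNorm_ne_of_inert {p : ℕ} (hp : p.Prime) (h : p = 2 ∨ p % 3 = 2) (I : Ideal (𝓞 K3)) : Ideal.absNorm I ≠ p := by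
  intro hI
  have hprime : I.IsPrime := Ideal.isPrime_of_irreducible_absNorm (by rw [hI]; exact hp)
  have hpmem : ((p : ℕ) : 𝓞 K3) ∈ I := by
    have hm := Ideal.absNorm_mem I
    rw [hI] at hm
    exact_mod_cast hm
  have hle : Ideal.span {((p : ℕ) : 𝓞 K3)} ≤ I := (Ideal.span_singleton_le_iff_mem _).mpr hpmem
  have hp0 : ((p : ℕ) : 𝓞 K3) ≠ 0 := by exact_mod_cast hp.ne_zero
  have hP : (Ideal.span {((p : ℕ) : 𝓞 K3)}).IsPrime := (Ideal.span_singleton_prime hp0).mpr (K3.prime_natCast_of_two_or_inert hp h)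
  have hM : (Ideal.span {((p : ℕ) : 𝓞 K3)}).IsMaximal := hP.isMaximal (by rw [Ne, Ideal.span_singleton_eq_bot]; exact hp0)
  have heq : Ideal.span {((p : ℕ) : 𝓞 K3)} = I := hM.eq_of_le hprime.ne_top hle
  have hsq : Ideal.absNorm I = p ^ 2 := by
    have hs := absNorm_span_natCast p
    have e : (((p : ℕ) : ℤ) : 𝓞 K3) = ((p : ℕ) : 𝓞 K3) := by push_cast; rfl
    rw [e, heq] at hs
    exact hs
  rw [hI] at hsq
  have h2 := hp.two_le
  nlinarith

/-- The Hecke sum of `HeckeThetaTwentySeven` vanishes at an inert prime: `a_p(27a3) = 0` for `p = 2` or `p ≡ 2 (mod 3)` prime (supersingular primes).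
UNCONDITIONAL. [cite: IrelandRosen1990, Ch. 18 §7] -/
theorem lFunction_twentySevenA3_eq_zero_of_inert {p : ℕ} (hp : p.Prime) (h : p = 2 ∨ p % 3 = 2) :
    (⟨0, 0, 1, 0, 0⟩ : WeierstrassCurve ℚ).LFunction p = 0 := by
  have hs := HeckeThetaTwentySeven.lFunction_twentySevenA3_eq_heckeSum p
  have hempty : idealsOfNorm K3 p = ∅ :=
    Finset.eq_empty_of_forall_notMem fun I hI ↦ absNorm_ne_of_inert hp h I (mem_idealsOfNorm.mp hI)
  rw [hempty, Finset.sum_empty] at hs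
  exact_mod_cast hs

/-- An ideal of norm `3` in `ℤ[ω]` is NOT prime to `(3)` (it contains `3`). [folklore] -/
theorem not_isCoprime_three_of_absNorm_eq_three {I : Ideal (𝓞 K3)} (hI : Ideal.absNorm I = 3) : ¬ IsCoprime I three := by
  intro hc
  have h3mem : ((3 : ℕ) : 𝓞 K3) ∈ I := by
    have hm := Ideal.absNorm_mem I
    rw [hI] at hm
    exact_mod_cast hm
  have hle : three ≤ I := by
    change Ideal.span {(3 : 𝓞 K3)} ≤ I
    exact (Ideal.span_singleton_le_iff_mem _).mpr (by exact_mod_cast h3mem)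
  have htop : I = ⊤ := by
    have h := Ideal.isCoprime_iff_sup_eq.mp hc
    rwa [sup_eq_left.mpr hle] at h
  rw [htop, Ideal.absNorm_top] at hI
  exact absurd hI (by norm_num)

/-- **`a₃(27a3) = 0`** (additive at `3`: the only ideal of norm `3` is the ramified prime, where `ν₁ = 0`). UNCONDITIONAL. [cite: IrelandRosen1990, Ch. 18 §7] -/
theorem lFunction_twentySevenA3_three : (⟨0, 0, 1, 0, 0⟩ : WeierstrassCurve ℚ).LFunction 3 = 0 := by
  have hs := HeckeThetaTwentySeven.lFunction_twentySevenA3_eq_heckeSum 3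
  have hzero : ∑ I ∈ idealsOfNorm K3 3, grossenNu (1 : 𝓞 K3) 1 0 I * embC (primGen I : K3) = 0 := by
    refine Finset.sum_eq_zero fun I hI ↦ ?_
    have hI3 := mem_idealsOfNorm.mp hI
    rw [HeckeThetaTwentySeven.grossenNu_one_apply, if_neg, zero_mul]
    rw [HeckeThetaTwentySeven.adm_one_iff]
    exact fun h ↦ not_isCoprime_three_of_absNorm_eq_three hI3 h.2
  rw [hzero] at hs
  exact_mod_cast hs

/-- `a_p(27a1) = 0` at the inert primes (`p = 2` or `p ≡ 2 (mod 3)`), UNCONDITIONALLY. [cite: IrelandRosen1990, Ch. 18 §7] -/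
theorem lFunction_twentySevenA1_eq_zero_of_inert {p : ℕ} (hp : p.Prime) (h : p = 2 ∨ p % 3 = 2) :
    (⟨0, 0, 1, 0, -7⟩ : WeierstrassCurve ℚ).LFunction p = 0 := by
  rw [lFunction_twentySevenA1_eq_twentySevenA3]; exact lFunction_twentySevenA3_eq_zero_of_inert hp h

/-- `a₃(27a1) = 0`, UNCONDITIONALLY. [cite: CremonaAlgorithms1997, Table 1 (27a1)] -/
theorem lFunction_twentySevenA1_three : (⟨0, 0, 1, 0, -7⟩ : WeierstrassCurve ℚ).LFunction 3 = 0 := by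
  rw [lFunction_twentySevenA1_eq_twentySevenA3]; exact lFunction_twentySevenA3_three

/-- `a_p(η(3τ)²η(9τ)²) = 0` at the inert primes. [cite: Koehler2011, §1] -/
theorem cuspCoeff_etaProductTwentySeven_eq_zero_of_inert {p : ℕ} (hp : p.Prime) (h : p = 2 ∨ p % 3 = 2) :
    cuspCoeff cuspFormEtaProductTwentySeven p = 0 := by
  rw [HeckeThetaTwentySeven.cuspCoeff_etaProductTwentySeven_eq_lFunction_twentySevenA3, lFunction_twentySevenA3_eq_zero_of_inert hp h, Int.cast_zero]

/-- **`hA11` discharged**: `a_{11}` of the `ℤ`-model `[0,0,1,0,−7]` base-changed to `ℚ` is even (it is `0`: `11 ≡ 2 (mod 3)`).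
[cite: CremonaAlgorithms1997, Table 1 (27a1)] -/
theorem even_lFunction_baseChange_twentySevenA1_eleven : Even (((⟨0, 0, 1, 0, -7⟩ : WeierstrassCurve ℤ).baseChange ℚ).LFunction 11) := by
  rw [IntModelTam.baseChange_rat_mk_int, ← LevelTwentySeven.mk_twentySevenA1_eq_cast,
    lFunction_twentySevenA1_eq_zero_of_inert (by norm_num) (Or.inr (by norm_num))]
  exact ⟨0, rfl⟩

/-- **`hA23` discharged**: `a_{23}` of the `ℤ`-model `[0,0,1,0,−7]` base-changed to `ℚ` is even (`23 ≡ 2 (mod 3)`). [cite: CremonaAlgorithms1997, Table 1 (27a1)] -/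
theorem even_lFunction_baseChange_twentySevenA1_twentyThree : Even (((⟨0, 0, 1, 0, -7⟩ : WeierstrassCurve ℤ).baseChange ℚ).LFunction 23) := by
  rw [IntModelTam.baseChange_rat_mk_int, ← LevelTwentySeven.mk_twentySevenA1_eq_cast,
    lFunction_twentySevenA1_eq_zero_of_inert (by norm_num) (Or.inr (by norm_num))]
  exact ⟨0, rfl⟩

/-- **`hA3` discharged**: `a₃` of the `ℤ`-model `[0,0,1,0,−7]` base-changed to `ℚ` is even (it is `0`). [cite: CremonaAlgorithms1997, Table 1 (27a1)] -/
theorem even_lFunction_baseChange_twentySevenA1_three : Even (((⟨0, 0, 1, 0, -7⟩ : WeierstrassCurve ℤ).baseChange ℚ).LFunction 3) := by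
  rw [IntModelTam.baseChange_rat_mk_int, ← LevelTwentySeven.mk_twentySevenA1_eq_cast, lFunction_twentySevenA1_three]
  exact ⟨0, rfl⟩

end Summit.BirchSwinnertonDyer.BirchSwinnertonDyer.Theorems.ManinLocalTwoThree.TwentySevenA1

end
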